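import Summits.Ventures.DiscreteObjects.PP12.OrderThirteenOrbitMatrix

/-!
# PP(12), order-13 cell: cross-difference TILES of valid lift data (the packing lemma behind the shape-level certificate)
Framing: lottery ticket; floor = certified bounds/negative ranges.

Cell pub-namedobj (venture DiscreteObjects), target (M), designs gen 19 (CERT-P13-DESIGN.md §1, lemma L4). For lift data `D` and two line orbits `s ≠ s'`, column `t`
contributes the finset of cross differences `D.crossDiff s s' t = {x − y : x ∈ E_{s,t}, y ∈ E_{s',t}}`. If `D` is valid ((U·U′): every non-zero residue is such a
difference exactly once, and the cells of a column are disjoint) then: `0` is never a cross difference (`zero_not_mem_crossDiff`), the tiles of different columns are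
DISJOINT (`crossDiff_disjoint`), each tile has full size `m_{s,t} · m_{s',t}` (`card_crossDiff`), and a tile is the translate by `x − y` of the difference set of the
SHAPES when the two cells are translates `x + S`, `y + S'` (`crossDiff_of_translate`). Consequently the shape tiles `S_t − S'_t` of any set of columns admit pairwise
disjoint translates inside `Z_p ∖ {0}` (`exists_disjoint_translates`) — the necessary condition ("packability") that the shape-level search of CERT-P13-DESIGN checks for
every row pair (and, via `OrderThirteenTranspose.valid_transpose`, for every column pair). Pure consequences of `LiftData.Valid`; no `sorry`, no new axioms, no census claim.
-/

namespace Summit.Ventures.DiscreteObjects.PP12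

namespace LiftData

open Finset

variable {N p : ℕ}

/-- the tile of column `t` for the row pair `(s, s')`: all differences `x − y`, `x ∈ E_{s,t}`, `y ∈ E_{s',t}` -/
def crossDiff (D : LiftData N p) (s s' t : Fin N) : Finset (Fin p) := image₂ (fun x y => x - y) (D.cell s t) (D.cell s' t)

/-- membership in a tile -/
theorem mem_crossDiff (D : LiftData N p) (s s' t : Fin N) (d : Fin p) :
    d ∈ D.crossDiff s s' t ↔ ∃ x y, D.mem s t x = true ∧ D.mem s' t y = true ∧ x - y = d := by
  simp only [crossDiff, mem_image₂, mem_cell]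
  constructor
  · rintro ⟨x, hx, y, hy, e⟩; exact ⟨x, y, hx, hy, e⟩
  · rintro ⟨x, y, hx, hy, e⟩; exact ⟨x, hx, y, hy, e⟩

variable [NeZero p]

/-- (U·U′, first clause): `0` is not a cross difference of two different rows -/
theorem zero_not_mem_crossDiff (D : LiftData N p) (hV : D.Valid) {s s' : Fin N} (hss : s ≠ s') (t : Fin N) : (0 : Fin p) ∉ D.crossDiff s s' t := by
  rw [mem_crossDiff]
  rintro ⟨x, y, hx, hy, e⟩
  have : x = y := sub_eq_zero.1 e
  subst this
  exact (hV.2 s s' hss).1 t x ⟨hx, hy⟩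

/-- (U·U′, uniqueness): a cross difference determines its column and its first element -/
theorem crossDiff_unique (D : LiftData N p) (hV : D.Valid) {s s' : Fin N} (hss : s ≠ s') {t t' : Fin N} {x y x' y' : Fin p}
    (hx : D.mem s t x = true) (hy : D.mem s' t y = true) (hx' : D.mem s t' x' = true) (hy' : D.mem s' t' y' = true) (e : x - y = x' - y') :
    t' = t ∧ x' = x := by
  have hd : x - y ≠ 0 := by
    intro h0
    have : x = y := sub_eq_zero.1 h0
    subst this
    exact (hV.2 s s' hss).1 t x ⟨hx, hy⟩
  obtain ⟨t₀, x₀, -, -, huniq⟩ := (hV.2 s s' hss).2 (x - y) hd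
  have e1 := huniq t x hx (by rw [sub_sub_cancel]; exact hy)
  have e2 := huniq t' x' hx' (by rw [e, sub_sub_cancel]; exact hy')
  exact ⟨e2.1.trans e1.1.symm, e2.2.trans e1.2.symm⟩

/-- **tiles of different columns are disjoint** -/
theorem crossDiff_disjoint (D : LiftData N p) (hV : D.Valid) {s s' : Fin N} (hss : s ≠ s') {t t' : Fin N} (htt : t ≠ t') :
    Disjoint (D.crossDiff s s' t) (D.crossDiff s s' t') := by
  rw [Finset.disjoint_left]
  intro d hd hd'
  rw [mem_crossDiff] at hd hd'
  obtain ⟨x, y, hx, hy, e⟩ := hd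
  obtain ⟨x', y', hx', hy', e'⟩ := hd'
  exact htt (D.crossDiff_unique hV hss hx hy hx' hy' (e.trans e'.symm)).1.symm

/-- **a tile has full size**: subtraction is injective on `E_{s,t} × E_{s',t}` -/
theorem card_crossDiff (D : LiftData N p) (hV : D.Valid) {s s' : Fin N} (hss : s ≠ s') (t : Fin N) :
    (D.crossDiff s s' t).card = D.om s t * D.om s' t := by
  unfold crossDiff om
  refine card_image₂_iff.2 ?_
  intro a ha b hb e
  simp only [Set.mem_prod, mem_coe, mem_cell] at ha hb
  have k := D.crossDiff_unique hV hss hb.1 hb.2 ha.1 ha.2 e.symm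
  have hx : a.1 = b.1 := k.2
  have hy : a.2 = b.2 := by
    have : a.1 - a.2 = b.1 - b.2 := e
    rw [hx] at this
    exact sub_right_injective this
  exact Prod.ext hx hy

/-- **tiles of translated shapes**: if `E_{s,t} = x + S` and `E_{s',t} = y + S'` then the tile is `(x − y) + (S − S')` -/
theorem crossDiff_of_translate (D : LiftData N p) {s s' t : Fin N} {S S' : Finset (Fin p)} {x y : Fin p}
    (hS : D.cell s t = S.image (fun a => x + a)) (hS' : D.cell s' t = S'.image (fun b => y + b)) :
    D.crossDiff s s' t = (image₂ (fun a b => a - b) S S').image (fun d => (x - y) + d) := by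
  unfold crossDiff
  rw [hS, hS']
  ext d
  simp only [mem_image₂, mem_image, exists_exists_and_eq_and]
  constructor
  · rintro ⟨a, ha, b, hb, e⟩
    exact ⟨a - b, ⟨a, ha, b, hb, rfl⟩, by rw [← e, add_sub_add_comm]⟩
  · rintro ⟨d', ⟨a, ha, b, hb, rfl⟩, rfl⟩
    exact ⟨a, ha, b, hb, add_sub_add_comm _ _ _ _⟩

/-- **packability of the shape tiles of a row pair**: if in the columns of a finset `T` the cells of rows `s ≠ s'` are translates `x_t + S_t`, `y_t + S'_t`, then the
translates `(x_t − y_t) + (S_t − S'_t)` are pairwise disjoint subsets of `Z_p ∖ {0}` — so SOME pairwise disjoint translates avoiding `0` exist, which is what the shape-level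
search checks (and refutes). -/
theorem exists_disjoint_translates (D : LiftData N p) (hV : D.Valid) {s s' : Fin N} (hss : s ≠ s') (T : Finset (Fin N))
    (S S' : Fin N → Finset (Fin p)) (x y : Fin N → Fin p)
    (hS : ∀ t ∈ T, D.cell s t = (S t).image (fun a => x t + a)) (hS' : ∀ t ∈ T, D.cell s' t = (S' t).image (fun b => y t + b)) :
    ∃ c : Fin N → Fin p,
      (∀ t ∈ T, (0 : Fin p) ∉ (image₂ (fun a b => a - b) (S t) (S' t)).image (fun d => c t + d)) ∧
      (∀ t ∈ T, ∀ t' ∈ T, t ≠ t' →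
        Disjoint ((image₂ (fun a b => a - b) (S t) (S' t)).image (fun d => c t + d)) ((image₂ (fun a b => a - b) (S t') (S' t')).image (fun d => c t' + d))) := by
  refine ⟨fun t => x t - y t, fun t ht => ?_, fun t ht t' ht' htt => ?_⟩
  · rw [← D.crossDiff_of_translate (hS t ht) (hS' t ht)]
    exact D.zero_not_mem_crossDiff hV hss t
  · rw [← D.crossDiff_of_translate (hS t ht) (hS' t ht), ← D.crossDiff_of_translate (hS t' ht') (hS' t' ht')]
    exact D.crossDiff_disjoint hV hss htt

end LiftData

end Summit.Ventures.DiscreteObjects.PP12
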